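import Summits.BirchSwinnertonDyer.BirchSwinnertonDyer.Theorems.ResidualThetaTransportAtTwoSignedMuSeedAtTwoPlusTiltRecursion
import HarnessLib

/-!
# Smoothing coboundary IV — the kernel cocycle CS1 reduced to the divisor identity: `D log` of
# `ψ_{αβ} = c·ψ_β^{Nα}·(ψ_α∘[β])` is `D log ψ_β + β̃·(D log ψ_α)∘[β]` (characteristic `2`, `Nα` odd, `[β]^*ω = β̃·ω`)
# (seed crux `SignedMuSeedAtTwoPlus` stmt-BirchSwinnertonDyer-21438; parent Kμ⁺ stmt-BirchSwinnertonDyer-20689, route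
# ResidualThetaTransportAtTwo; line card `Cruxes/SignedMuSeedAtTwoPlus/Lines/smoothing-coboundary.md`, stub CS1 `KernelCocycle`)

Cell `bsd-wall`, width seat `bsd-wall-rtt-p4-w2` g15 (`--supports`, closes nothing).  THEOREMS ONLY; BSD is not proved by this.

Currency of the line's power-series files (`…TiltRecursion`, `…TiltCoboundary`): `D = u·d/dt`, "`S = D log Z`" is the
division-free relation `Z * S = u * Z'`, composition with an endomorphism `[β]` of the formal group is `PowerSeries.subst φ`
(`φ(0) = 0`).  `…TiltRecursion` treats INVARIANT substitutions `u·φ' = u∘φ` (`[h]^*ω = ω`, `h ≡ 1 (mod 2)`); the smoothing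
element `β` of the card is a general odd element with TANGENT SCALAR `β̃`, i.e. `[β]^*ω = β̃·ω`, which in this currency is the
twisted invariance `u·φ' = C b · u∘φ`.  Proved here, for an arbitrary commutative ring `k` unless said:

* `mul_derivative_subst_of_twisted` — `u·φ' = C b·u∘φ ⟹ D(f∘φ) = b·(D f)∘φ` (chain rule);
* `logDeriv_subst_twisted` — `Z S = u Z' ⟹ (Z∘φ)·(C b·S∘φ) = u·(Z∘φ)'`;
* `logDeriv_C_mul` — constants have zero `D log`; `logDeriv_pow` — `Zⁿ·(n•S) = u·(Zⁿ)'`; `logDeriv_pow_odd` — in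
  characteristic `2`, `n` odd: `Zⁿ·S = u·(Zⁿ)'`;
* **`kernelCocycle_logDeriv`** (CS1, algebraic half): from the divisor identity `F_{αβ} = C c · F_β ^ n · F_α∘φ` (`n = Nα` odd),
  `F_α Φ_α = u F_α'`, `F_β Φ_β = u F_β'` and `u·φ' = C b·u∘φ`:  `F_{αβ} · (Φ_β + C b · Φ_α∘φ) = u · F_{αβ}'` — i.e.
  `L(αβ) = L(β) + β̃·L(α)∘[β]`, the TWISTED COCYCLE LAW of the card, modulo the divisor identity on `Ẽ` and `[β]^*ω = β̃ω`;
* `kernelCocycle_logDeriv_eq` — over a domain with `F_{αβ} ≠ 0` the `D log` is unique, so any `Φ_{αβ}` with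
  `F_{αβ} Φ_{αβ} = u F_{αβ}'` EQUALS `Φ_β + C b · Φ_α∘φ`.

Not here: the divisor identity itself (zeros/poles of the `x`-kernel polynomials on the complete curve) and the tangent
character `β ↦ β̃` — geometric statements about `TiltCurve`, stub CS1's other half. [folklore]
-/

noncomputable section

set_option autoImplicit false
-- the Theorems namespace of this sub repeats the summit name by design (D-0017 nested layout)
set_option linter.dupNamespace false

open PowerSeries

namespace Summit.BirchSwinnertonDyer.BirchSwinnertonDyer.Theorems.SignedMuAtTwo.SmoothingCoboundary

variable {k : Type*} [CommRing k]

/-- **Twisted chain rule**: if `φ(0) = 0` and `u·φ' = C b·u∘φ` (`[β]^*ω = β̃·ω`) then `D(f∘φ) = b·(D f)∘φ` for `D = u·d/dt`: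
`u·(f∘φ)' = C b·(u·f')∘φ`. [folklore] -/
theorem mul_derivative_subst_of_twisted {u φ : PowerSeries k} (hφ : constantCoeff φ = 0) {b : k}
    (htw : u * d⁄dX k φ = C b * u.subst φ) (f : PowerSeries k) :
    u * d⁄dX k (f.subst φ) = C b * (u * d⁄dX k f).subst φ := by
  have hs : HasSubst φ := HasSubst.of_constantCoeff_zero' hφ
  rw [derivative_subst (A := k) hs, subst_mul hs, mul_left_comm, htw]
  ring

/-- Transport of a `D log` relation along a twisted-invariant substitution:
`Z S = u Z'`, `u·φ' = C b·u∘φ` ⟹ `(Z∘φ)·(C b·S∘φ) = u·(Z∘φ)'`. [folklore] -/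
theorem logDeriv_subst_twisted {u φ Z S : PowerSeries k} (hφ : constantCoeff φ = 0) {b : k}
    (htw : u * d⁄dX k φ = C b * u.subst φ) (hS : Z * S = u * d⁄dX k Z) :
    Z.subst φ * (C b * S.subst φ) = u * d⁄dX k (Z.subst φ) := by
  have hs : HasSubst φ := HasSubst.of_constantCoeff_zero' hφ
  rw [mul_derivative_subst_of_twisted hφ htw, ← hS, subst_mul hs]
  ring

/-- Constants have zero `D log`: `Z S = u Z'` ⟹ `(C c·Z)·S = u·(C c·Z)'`. [folklore] -/
theorem logDeriv_C_mul {u Z S : PowerSeries k} (c : k) (hS : Z * S = u * d⁄dX k Z) :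
    (C c * Z) * S = u * d⁄dX k (C c * Z) := by
  rw [Derivation.leibniz, derivative_C, smul_zero, add_zero, smul_eq_mul, mul_assoc, hS]
  ring

/-- `D log` of a power: `Z S = u Z'` ⟹ `Zⁿ·(n•S) = u·(Zⁿ)'`. [folklore] -/
theorem logDeriv_pow {u Z S : PowerSeries k} (hS : Z * S = u * d⁄dX k Z) (n : ℕ) :
    Z ^ n * (n • S) = u * d⁄dX k (Z ^ n) := by
  induction n with
  | zero => simp
  | succ n ih =>
    rw [pow_succ, Derivation.leibniz, smul_eq_mul, smul_eq_mul, mul_add]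
    have e1 : u * (Z ^ n * d⁄dX k Z) = Z ^ n * (Z * S) := by rw [hS]; ring
    have e2 : u * (Z * d⁄dX k (Z ^ n)) = Z * (Z ^ n * n • S) := by rw [ih]; ring
    rw [e1, e2, succ_nsmul]
    ring

/-- In characteristic `2`, for `n` ODD: `Z S = u Z'` ⟹ `Zⁿ·S = u·(Zⁿ)'` (`D log ψ^{Nα} = Nα·D log ψ = D log ψ`). [folklore] -/
theorem logDeriv_pow_odd [CharP k 2] {u Z S : PowerSeries k} (hS : Z * S = u * d⁄dX k Z) {n : ℕ} (hn : Odd n) :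
    Z ^ n * S = u * d⁄dX k (Z ^ n) := by
  rw [← logDeriv_pow hS n]
  obtain ⟨m, rfl⟩ := hn
  congr 1
  have h2 : ∀ T : PowerSeries k, T + T = 0 := fun T => by
    ext i; rw [map_add, CharTwo.add_self_eq_zero, map_zero]
  rw [add_smul, one_smul, mul_smul, two_smul, h2, zero_add]

/-- **The kernel cocycle, algebraic half** (stub CS1 `KernelCocycle` of the line card modulo the divisor identity):
in characteristic `2`, if `F_α Φ_α = u F_α'`, `F_β Φ_β = u F_β'` (`Φ = D log F`, `D = u·d/dt`), the substitution `φ = [β]`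
satisfies `φ(0) = 0` and `u·φ' = C b·u∘φ` (`[β]^*ω = β̃ω`, `b = β̃`), `n = Nα` is odd, and the DIVISOR IDENTITY
`F_{αβ} = C c · F_β ^ n · F_α∘φ` holds, then `F_{αβ} · (Φ_β + C b · Φ_α∘φ) = u · F_{αβ}'`:
`D log ψ_{αβ} = D log ψ_β + β̃·(D log ψ_α)∘[β]` — the twisted cocycle law `L(αβ) = L(β) + β̃·L(α)∘[β]`. [folklore] -/
theorem kernelCocycle_logDeriv [CharP k 2] {u φ Fα Φα Fβ Φβ Fαβ : PowerSeries k} {b c : k} {n : ℕ}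
    (hφ : constantCoeff φ = 0) (htw : u * d⁄dX k φ = C b * u.subst φ)
    (hα : Fα * Φα = u * d⁄dX k Fα) (hβ : Fβ * Φβ = u * d⁄dX k Fβ) (hn : Odd n)
    (hdiv : Fαβ = C c * Fβ ^ n * Fα.subst φ) :
    Fαβ * (Φβ + C b * Φα.subst φ) = u * d⁄dX k Fαβ := by
  rw [hdiv]
  exact Tilt.logDeriv_mul (logDeriv_C_mul c (logDeriv_pow_odd hβ hn)) (logDeriv_subst_twisted hφ htw hα)

/-- **The kernel cocycle as an equality of `D log`s**: over a domain, with `F_{αβ} ≠ 0`, ANY `Φ_{αβ}` with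
`F_{αβ} Φ_{αβ} = u F_{αβ}'` equals `Φ_β + C b · Φ_α∘φ` (uniqueness of `D log`, `Tilt.logDeriv_unique`-style cancellation).
[folklore] -/
theorem kernelCocycle_logDeriv_eq [CharP k 2] [NoZeroDivisors k] {u φ Fα Φα Fβ Φβ Fαβ Φαβ : PowerSeries k}
    {b c : k} {n : ℕ} (hφ : constantCoeff φ = 0) (htw : u * d⁄dX k φ = C b * u.subst φ)
    (hα : Fα * Φα = u * d⁄dX k Fα) (hβ : Fβ * Φβ = u * d⁄dX k Fβ) (hn : Odd n)
    (hdiv : Fαβ = C c * Fβ ^ n * Fα.subst φ) (hne : Fαβ ≠ 0) (hαβ : Fαβ * Φαβ = u * d⁄dX k Fαβ) :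
    Φαβ = Φβ + C b * Φα.subst φ :=
  mul_left_cancel₀ hne (hαβ.trans (kernelCocycle_logDeriv hφ htw hα hβ hn hdiv).symm)

/-- The untwisted case `b = 1` (`β ≡ 1 (mod 2)`, `[β]^*ω = ω`) is `…TiltRecursion`'s invariant setting:
`u·φ' = u∘φ ⟹ u·φ' = C 1·u∘φ`. [folklore] -/
theorem twisted_of_invariant {u φ : PowerSeries k} (hinv : u * d⁄dX k φ = u.subst φ) :
    u * d⁄dX k φ = C (1 : k) * u.subst φ := by
  rw [map_one, one_mul, hinv]

end Summit.BirchSwinnertonDyer.BirchSwinnertonDyer.Theorems.SignedMuAtTwo.SmoothingCoboundary
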